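import Summits.MatrixMultiplication.MatrixMultiplication.Theses.DefinableSTPPDichotomy
import Summits.MatrixMultiplication.MatrixMultiplication.Theorems.PairwiseCurvedTilingsLC.Negative.UniformEta
import Literature.Barriers.MatrixMultiplication.TricoloredSumFreeBarrierEffective

/-!
# Disproof of `HexagonClearanceR` (stmt-MatrixMultiplication-17884) — findings

Standing disprover's work file (cdisprove, cycle 1, 2026-08-17).  Crux (route DefinableSTPPDichotomy,
THE SEAM, repaired rev 2–4):

  `R := ∀ formulas Φ = (e,m,k,φ_I,φ_A,φ_B,φ_C), ∃ ε₀ > 0, ∀ 0 < ε ≤ ε₀, ∀ η > 0, ∃ q₁, ∀ finite fields F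
   with char F ≥ q₁, ∀ realised families (A_x,B_x,C_x)_{x∈I} in F^m:
   pairwise (≥2-equal-label) STPP clause ∧ |F|^{m+η} ≤ Σ_I (abc)^{(2+ε)/3}
   ⟹ ∃ J ⊆ I fully STPP with |F|^m < Σ_J (abc)^{(2+ε)/3}`.

## Verdict of this cycle: NO KILL — and why none is expected

* §0 `pairwiseCurvedTilingsLC_of_not_hexagonClearanceR : ¬R → LC` (kernel-checked, 20 lines; first
  noted in `Cruxes/HexagonClearanceR/BirthVetting.lean`).  A refutation of the seam needs, for ONE
  Φ and EVERY ε₀, a realised pairwise-STPP definable family of mass `≥ |F|^{m+η}` in arbitrarily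
  large characteristic — verbatim an LC-witness for Φ (crux #2, rated open-problem).  No LC-witness
  is known; worse for the attacker, `Cruxes/PairwiseCurvedTilingsLC/LonelyTranslates.lean §3` PROVES
  `notLC_of_recurrence : DefinableTranslateRecurrence → ¬LC` (rc 0, 0 sorries), where
  `DefinableTranslateRecurrence` is a Galois-stratification + uniform-Chebotarev recurrence
  principle for definable sets over finite fields (Fried–Sacerdote–Jarden / Kiefe / CDM /
  Katz–Sarnak 9.7.13 shaped; I re-derived it informally: a point `t` of a top-dimensional Galois
  cell is unramified, its Frobenius class recurs with density `≥ 1/|G|` along any definable curve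
  through it, lower cells go to the exceptional set `E`, `|E| = O(q^{m-1})`).  Composing:
      `DefinableTranslateRecurrence → ¬LC → R`,
  i.e. **the seam is TRUE (vacuously) modulo a classical theorem of field arithmetic**, uniformly in
  the characteristic.  Every refutation of R would refute that recurrence principle.  (The two crux
  files are not importable on the farm — "unbuilt" — so the composition is by hand; §0 re-proves
  the half that lives here.)
* §0 also records WHERE NO WITNESS CAN LIVE: the hypotheses force `η ≤ mε/3`
  (`hypotheses_force_eta_le`, from the landed `PairwiseCurvedTilingsLC.Negative.eta_le`), so R is
  outright true for `η > mε/3` (`hexagonClearanceR_of_large_eta`); an attacker must take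
  `η = O(ε) → 0`, blocks of size `≥ q^{3η/ε}`, packings tight up to `q^{O(ε)}` — the (d,d,d),
  `e = m − 2d`, `|I| ≍ q^e` numerology of the item docstring (CDM).

## Load-bearing hypotheses (each a sorry-free `¬ RWithout<H>`; landed def-free under
## Theorems/HexagonClearanceR/Negative/: LoadBearingEtaPairwise p146972, LoadBearingProvisos p146975,
## WithoutEps0OfNonlinearRoth p147419)

* §1 `hexagonClearanceR_false_without_eta` — `0 < η` is load-bearing: at `η = 0` the dilated point
  family `{x},{2x},{4x}` in `𝔽_p` (`m = e = 1`, `p ≥ 5`) is pairwise clean with mass EXACTLY `|F|^m`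
  and no sub-family exceeds `|F|^m`.  (So the gap between hypothesis exponent `m+η` and conclusion
  exponent `m` cannot be closed from the hypothesis side.)
* §2 `hexagonClearanceR_false_without_pairwise` — the `≥2`-equal-label clause is load-bearing: the
  constant family `{0},{0},{0}` over `I = F²`, `m = 1`, has mass `|F|^{m+1}` and clean sub-families of
  ONE label.
* §3 `hexagonClearanceR_false_without_eps0_char` — the two repair provisos {`ε ≤ ε₀`, `q₁ ≤ char F`}
  are JOINTLY load-bearing even with the repaired δ-free conclusion: drop both and the old parasite
  (`GF(3ⁿ)`, `A_x = {x}×F`, `B_x = {0}`, `C_x = {(−x,−x)}`) at `ε = 1 + 3c₃/2`, `η = c₃/2` has mass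
  `q^{2+η}` while clean `J` are cap sets, `mass_J ≤ 3q^{2−c₃/2} < q²` (tree `card_le_rpow_of_elementary`).

## Provisos taken ONE at a time (analysis; no theorem possible/needed this cycle)

* `q₁ ≤ ringChar F` ALONE (keep `ε ≤ ε₀`): NOT load-bearing modulo `DefinableTranslateRecurrence` —
  `notLC_of_recurrence` uses neither large characteristic nor `∀ε` (its docstring), so the
  all-characteristic seam (`q₁ ≤ |F|`) is vacuously true by the same chain.  Information for the
  planner: after `ε ≤ ε₀` the characteristic proviso only matters in the world where tight definable
  pairwise tilings exist in bounded characteristic (Artin–Schreier-definable subgroups); none known.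
* `ε ≤ ε₀` ALONE (keep large characteristic): LOAD-BEARING modulo Bourgain–Chang 2017 Cor 1.2 — §4,
  `hexagonClearanceR_false_without_eps0_of_nonlinearRoth : NonlinearRothBC → ¬RWithoutEps0`
  (sorry-free; landed def-free, p147419).  Label-only parasites only give relations
  `f(i) + g(j) = (f+g)(k)` (linear ⇒ Behrend clears; nonlinear ⇒ no Roth bound in print, §5); the
  kill came from a NEW shape, the MOMENT FAN in `F⁵` — lines whose directions move with the label
  along conics — whose hexagon relation is exactly the Bourgain–Chang progression `x, x+y, x+y²`.
  So large characteristic does NOT substitute for `ε ≤ ε₀`: nonlinear hexagon relations keep a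
  power saving as `p → ∞`.
* definability dropped (arbitrary families in `F^m` or any abelian group): refuting even that needs a
  tight pairwise-STPP family with power-sparse clean sub-families; I know no tight pairwise-STPP
  family at all in bounded rank with `|I| → ∞` (frames ≤ 2 blocks; translate families `|I|·abc ≤ q^m`;
  digit/interval blocks in `ℤ_p` behave like frames).  Open, likely as hard as LC's combinatorial core.

## -- Targets
None this cycle (payload `stuck_stubs = []`, no line picked).  When a line is picked, its stubs of the
shape "tight pairwise tiling ⟹ graded/levelled" (cards zero-sum-deficit-level-rigidity,
seam-forced-grading) are the ones a disprover can test on the §4 parasite shapes and on cylinder-graded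
families (card rank-induction claims R FALSE on cylinder-graded tight tilings — if any existed).

Cited/used: BirthVetting.lean (¬LC→R); LonelyTranslates.lean §3 (DTR→¬LC) and
NEGATIVE-chebotarev-curve-recurrence.md; Theorems/PairwiseCurvedTilingsLC/Negative/UniformEta.lean
(`eta_le`); Theorems/DefinableSTPPDichotomyHexagonClearanceRefutation.lean (parasite code, adapted in §3);
Literature `card_le_rpow_of_elementary`, `foxLovaszExponent_pos`.
-/

set_option linter.dupNamespace false

namespace Summit.MatrixMultiplication.MatrixMultiplication.Cruxes.HexagonClearanceR.Disproof

open Finset FirstOrder FirstOrder.Language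
open Summit.MatrixMultiplication.MatrixMultiplication.Theses.DefinableSTPPDichotomy

noncomputable section

/-! ## §0  Why the crux resists: `¬ LC → R`, and `¬ LC` modulo a Chebotarev recurrence principle -/

/-- Monotonicity of one mass term in the exponent: bases are natural numbers (`0` or `≥ 1`).
(BirthVetting.lean, re-proved here because crux workfiles are not importable.) -/
theorem rpow_natCast_mono {n : ℕ} {a b : ℝ} (ha : 0 < a) (hab : a ≤ b) :
    (n : ℝ) ^ a ≤ (n : ℝ) ^ b := by
  rcases Nat.eq_zero_or_pos n with h0 | hpos
  · subst h0
    rw [Nat.cast_zero, Real.zero_rpow ha.ne', Real.zero_rpow (by linarith : (0:ℝ) < b).ne']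
  · exact Real.rpow_le_rpow_of_exponent_le (by exact_mod_cast hpos) hab

/-- **`¬ LC → R`** (BirthVetting.lean `hexagonClearanceR_of_not_pairwiseCurvedTilingsLC`, re-proved):
the seam's hypotheses at `ε ≤ ε₀` are satisfiable for given formulas iff those formulas are an
LC-witness, so the seam holds VACUOUSLY unless the dodge succeeds with the same formulas; every
refutation of `HexagonClearanceR` is a proof of `PairwiseCurvedTilingsLC`. -/
theorem hexagonClearanceR_of_not_LC (h : ¬ PairwiseCurvedTilingsLC) : HexagonClearanceR := by
  intro e m k φI φA φB φC
  by_contra hR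
  apply h
  refine ⟨e, m, k, φI, φA, φB, φC, fun ε hε => ?_⟩
  by_contra hη
  apply hR
  refine ⟨ε, hε, fun ε' η hε' hle hη' => ?_⟩
  by_contra hq
  apply hη
  refine ⟨η, hη', fun q₀ => ?_⟩
  by_contra hF
  apply hq
  refine ⟨q₀, ?_⟩
  intro F instF instFin instCR hchar y I A B C hI hA hB hC hpair hmass
  exfalso
  apply hF
  refine ⟨F, instF, instFin, instCR, hchar, y, I, A, B, C, hI, hA, hB, hC, hpair, ?_⟩
  calc (Fintype.card F : ℝ) ^ ((m : ℝ) + η)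
      ≤ ∑ x ∈ I, (((A x).card * (B x).card * (C x).card : ℕ) : ℝ) ^ ((2 + ε') / 3) := hmass
    _ ≤ ∑ x ∈ I, (((A x).card * (B x).card * (C x).card : ℕ) : ℝ) ^ ((2 + ε) / 3) :=
        Finset.sum_le_sum fun x _ => rpow_natCast_mono (by linarith) (by linarith)

/-- Contrapositive, the form the disprover needs: **a kill of the seam is an LC-witness**. -/
theorem pairwiseCurvedTilingsLC_of_not_hexagonClearanceR (h : ¬ HexagonClearanceR) :
    PairwiseCurvedTilingsLC := by
  by_contra h'
  exact h (hexagonClearanceR_of_not_LC h')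

/-- **Where no witness can live, I: the admissible window `η ≤ m ε / 3`.**  For EVERY family meeting
the seam's two hypotheses (pairwise clause + mass bound; definability, field size and characteristic
irrelevant) the exponent gain satisfies `η ≤ m ε / 3` (three packings + AM–GM + block TPP, the tree's
`PairwiseCurvedTilingsLC.Negative.eta_le`).  So for `η > m ε₀ / 3` the seam is vacuous, and a
disproof must work with `η = O(ε) → 0`: blocks of size `≥ q^{3η/ε}` and packings tight up to
`q^{mε/3 − η}`. -/
theorem hypotheses_force_eta_le {F : Type} [Field F] [Fintype F] {e m : ℕ} {I : Finset (Fin e → F)}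
    {A B C : (Fin e → F) → Finset (Fin m → F)}
    (hP : ∀ i ∈ I, ∀ j ∈ I, ∀ k ∈ I, (i = j ∨ j = k ∨ k = i) →
      ∀ s ∈ A k, ∀ s' ∈ A i, ∀ t ∈ B i, ∀ t' ∈ B j, ∀ u ∈ C j, ∀ u' ∈ C k,
        (s' - s) + (t' - t) + (u' - u) = 0 → i = j ∧ j = k ∧ s = s' ∧ t = t' ∧ u = u')
    {ε η : ℝ} (hε : 0 < ε)
    (hmass : (Fintype.card F : ℝ) ^ ((m : ℝ) + η) ≤
      ∑ x ∈ I, (((A x).card * (B x).card * (C x).card : ℕ) : ℝ) ^ ((2 + ε) / 3)) :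
    η ≤ m * ε / 3 :=
  Summit.MatrixMultiplication.MatrixMultiplication.Theorems.PairwiseCurvedTilingsLC.Negative.eta_le
    hP hε.le hmass

/-- **Where no witness can live, II: the seam restricted to `η > m ε / 3` holds outright** (vacuously;
any `q₁` works). -/
theorem hexagonClearanceR_of_large_eta (e m k : ℕ)
    (φI : FirstOrder.Language.ring.Formula (Fin e ⊕ Fin k))
    (φA φB φC : FirstOrder.Language.ring.Formula ((Fin e ⊕ Fin m) ⊕ Fin k))
    (ε η : ℝ) (hε : 0 < ε) (hη : m * ε / 3 < η) (F : Type) [Field F] [Fintype F]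
    [FirstOrder.Ring.CompatibleRing F] (y : Fin k → F) (I : Finset (Fin e → F))
    (A B C : (Fin e → F) → Finset (Fin m → F))
    (_hI : ∀ x, x ∈ I ↔ φI.Realize (Sum.elim x y))
    (_hA : ∀ x v, v ∈ A x ↔ φA.Realize (Sum.elim (Sum.elim x v) y))
    (_hB : ∀ x v, v ∈ B x ↔ φB.Realize (Sum.elim (Sum.elim x v) y))
    (_hC : ∀ x v, v ∈ C x ↔ φC.Realize (Sum.elim (Sum.elim x v) y))
    (hP : ∀ i ∈ I, ∀ j ∈ I, ∀ k ∈ I, (i = j ∨ j = k ∨ k = i) →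
      ∀ s ∈ A k, ∀ s' ∈ A i, ∀ t ∈ B i, ∀ t' ∈ B j, ∀ u ∈ C j, ∀ u' ∈ C k,
        (s' - s) + (t' - t) + (u' - u) = 0 → i = j ∧ j = k ∧ s = s' ∧ t = t' ∧ u = u')
    (hmass : (Fintype.card F : ℝ) ^ ((m : ℝ) + η) ≤
      ∑ x ∈ I, (((A x).card * (B x).card * (C x).card : ℕ) : ℝ) ^ ((2 + ε) / 3)) :
    ∃ J : Finset (Fin e → F), J ⊆ I ∧
      (∀ i ∈ J, ∀ j ∈ J, ∀ k ∈ J, ∀ s ∈ A k, ∀ s' ∈ A i, ∀ t ∈ B i, ∀ t' ∈ B j,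
        ∀ u ∈ C j, ∀ u' ∈ C k, (s' - s) + (t' - t) + (u' - u) = 0 →
          i = j ∧ j = k ∧ s = s' ∧ t = t' ∧ u = u') ∧
      (Fintype.card F : ℝ) ^ (m : ℝ) <
        ∑ x ∈ J, (((A x).card * (B x).card * (C x).card : ℕ) : ℝ) ^ ((2 + ε) / 3) :=
  absurd (hypotheses_force_eta_le hP hε hmass) (not_le.2 hη)

/-! ## §1  `0 < η` is load-bearing: at `η = 0` point families meet every hypothesis -/

/-- `HexagonClearanceR` with the mass hypothesis at `η = 0`, i.e. `|F|^m ≤ mass_I` (everything else —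
`ε ≤ ε₀`, large characteristic, the pairwise clause, the `δ`-free conclusion — unchanged). -/
def HexagonClearanceRWithoutEta : Prop :=
  ∀ (e m k : ℕ) (φI : Language.ring.Formula (Fin e ⊕ Fin k))
    (φA φB φC : Language.ring.Formula ((Fin e ⊕ Fin m) ⊕ Fin k)),
    ∃ ε₀ : ℝ, 0 < ε₀ ∧ ∀ ε : ℝ, 0 < ε → ε ≤ ε₀ → ∃ q₁ : ℕ,
      ∀ (F : Type) [Field F] [Fintype F] [FirstOrder.Ring.CompatibleRing F], q₁ ≤ ringChar F →
        ∀ (y : Fin k → F) (I : Finset (Fin e → F)) (A B C : (Fin e → F) → Finset (Fin m → F)),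
          (∀ x, x ∈ I ↔ φI.Realize (Sum.elim x y)) →
          (∀ x v, v ∈ A x ↔ φA.Realize (Sum.elim (Sum.elim x v) y)) →
          (∀ x v, v ∈ B x ↔ φB.Realize (Sum.elim (Sum.elim x v) y)) →
          (∀ x v, v ∈ C x ↔ φC.Realize (Sum.elim (Sum.elim x v) y)) →
          (∀ i ∈ I, ∀ j ∈ I, ∀ k ∈ I, (i = j ∨ j = k ∨ k = i) →
            ∀ s ∈ A k, ∀ s' ∈ A i, ∀ t ∈ B i, ∀ t' ∈ B j, ∀ u ∈ C j, ∀ u' ∈ C k,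
              (s' - s) + (t' - t) + (u' - u) = 0 → i = j ∧ j = k ∧ s = s' ∧ t = t' ∧ u = u') →
          (Fintype.card F : ℝ) ^ (m : ℝ) ≤
            ∑ x ∈ I, (((A x).card * (B x).card * (C x).card : ℕ) : ℝ) ^ ((2 + ε) / 3) →
          ∃ J : Finset (Fin e → F), J ⊆ I ∧
            (∀ i ∈ J, ∀ j ∈ J, ∀ k ∈ J, ∀ s ∈ A k, ∀ s' ∈ A i, ∀ t ∈ B i, ∀ t' ∈ B j,
              ∀ u ∈ C j, ∀ u' ∈ C k, (s' - s) + (t' - t) + (u' - u) = 0 →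
                i = j ∧ j = k ∧ s = s' ∧ t = t' ∧ u = u') ∧
            (Fintype.card F : ℝ) ^ (m : ℝ) <
              ∑ x ∈ J, (((A x).card * (B x).card * (C x).card : ℕ) : ℝ) ^ ((2 + ε) / 3)

/-- The point block `{(c·x₀)}` in `F¹`, for a natural-number dilation factor `c`. -/
def dilPt (c : ℕ) (F : Type) [Field F] (x : Fin 1 → F) : Finset (Fin 1 → F) :=
  {fun _ => (c : F) * x 0}

theorem mem_dilPt {c : ℕ} {F : Type} [Field F] {x v : Fin 1 → F} :
    v ∈ dilPt c F x ↔ v = fun _ => (c : F) * x 0 :=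
  Finset.mem_singleton

theorem card_dilPt (c : ℕ) (F : Type) [Field F] (x : Fin 1 → F) : (dilPt c F x).card = 1 :=
  Finset.card_singleton _

/-- Ring formula `v₀ = x₀` (label `x : Fin 1`, vector `v : Fin 1`, no parameters). -/
def ψ1 : Language.ring.Formula ((Fin 1 ⊕ Fin 1) ⊕ Fin 0) :=
  Term.equal (Term.var (Sum.inl (Sum.inr 0))) (Term.var (Sum.inl (Sum.inl 0)))

/-- Ring formula `v₀ = x₀ + x₀`. -/
def ψ2 : Language.ring.Formula ((Fin 1 ⊕ Fin 1) ⊕ Fin 0) :=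
  Term.equal (Term.var (Sum.inl (Sum.inr 0)))
    (Term.var (Sum.inl (Sum.inl 0)) + Term.var (Sum.inl (Sum.inl 0)))

/-- Ring formula `v₀ = (x₀ + x₀) + (x₀ + x₀)`. -/
def ψ4 : Language.ring.Formula ((Fin 1 ⊕ Fin 1) ⊕ Fin 0) :=
  Term.equal (Term.var (Sum.inl (Sum.inr 0)))
    ((Term.var (Sum.inl (Sum.inl 0)) + Term.var (Sum.inl (Sum.inl 0))) +
      (Term.var (Sum.inl (Sum.inl 0)) + Term.var (Sum.inl (Sum.inl 0))))

theorem mem_dilPt1_iff_realize {F : Type} [Field F] [FirstOrder.Ring.CompatibleRing F]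
    (y : Fin 0 → F) (x v : Fin 1 → F) :
    v ∈ dilPt 1 F x ↔ ψ1.Realize (Sum.elim (Sum.elim x v) y) := by
  rw [mem_dilPt]
  simp [ψ1, Formula.realize_equal, funext_iff, Fin.forall_fin_one]

theorem mem_dilPt2_iff_realize {F : Type} [Field F] [FirstOrder.Ring.CompatibleRing F]
    (y : Fin 0 → F) (x v : Fin 1 → F) :
    v ∈ dilPt 2 F x ↔ ψ2.Realize (Sum.elim (Sum.elim x v) y) := by
  rw [mem_dilPt]
  simp [ψ2, Formula.realize_equal, funext_iff, Fin.forall_fin_one, two_mul]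

theorem mem_dilPt4_iff_realize {F : Type} [Field F] [FirstOrder.Ring.CompatibleRing F]
    (y : Fin 0 → F) (x v : Fin 1 → F) :
    v ∈ dilPt 4 F x ↔ ψ4.Realize (Sum.elim (Sum.elim x v) y) := by
  rw [mem_dilPt]
  have h4 : (4 : F) * x 0 = (x 0 + x 0) + (x 0 + x 0) := by ring
  simp [ψ4, Formula.realize_equal, funext_iff, Fin.forall_fin_one, h4]

/-- **`0 < η` is load-bearing.**  At `η = 0` the DILATED POINT family `A_x = {x}`, `B_x = {2x}`,
`C_x = {4x}` (`x ∈ I = F`, `m = e = 1`) over prime fields `𝔽_p`, `p ≥ max(q₁, 5)`, satisfies every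
`≥ 2`-equal-label pattern (the hexagon relation is `i + 2j = 3k`, injective in each variable once
`2, 3 ≠ 0`), has mass exactly `|I| = p = |F|^m` at every exponent, and NO sub-family can exceed
`|F|^m` (each block weighs `1`, `|J| ≤ p`).  So the conclusion's strict `|F|^m < mass_J` needs the
hypothesis' extra `|F|^η`. -/
theorem hexagonClearanceR_false_without_eta : ¬ HexagonClearanceRWithoutEta := by
  intro H
  classical
  obtain ⟨ε₀, hε₀, H1⟩ := H 1 1 0 ⊤ ψ1 ψ2 ψ4
  obtain ⟨q₁, H2⟩ := H1 ε₀ hε₀ le_rfl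
  obtain ⟨p, hpge, hp⟩ := Nat.exists_infinite_primes (max q₁ 5)
  haveI : Fact p.Prime := ⟨hp⟩
  let F := ZMod p
  letI : FirstOrder.Ring.CompatibleRing F := FirstOrder.Ring.compatibleRingOfRing F
  have hchar : q₁ ≤ ringChar F := by
    rw [ZMod.ringChar_zmod_n]
    exact (le_max_left _ _).trans hpge
  have hp5 : 5 ≤ p := (le_max_right _ _).trans hpge
  have hne : ∀ n : ℕ, 0 < n → n < 5 → ((n : ℕ) : F) ≠ 0 := by
    intro n hn0 hn5 h
    have hdvd : p ∣ n := (ZMod.natCast_eq_zero_iff n p).1 h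
    have := Nat.le_of_dvd hn0 hdvd
    omega
  have h2 : (2 : F) ≠ 0 := by exact_mod_cast hne 2 (by norm_num) (by norm_num)
  have h3 : (3 : F) ≠ 0 := by exact_mod_cast hne 3 (by norm_num) (by norm_num)
  have key := H2 F hchar ![] univ (dilPt 1 F) (dilPt 2 F) (dilPt 4 F) (fun x => by simp)
    (mem_dilPt1_iff_realize ![]) (mem_dilPt2_iff_realize ![]) (mem_dilPt4_iff_realize ![])
  obtain ⟨J, -, -, hJmass⟩ := key
    (by
      intro i _ j _ k _ hcase s hs s' hs' t ht t' ht' u hu u' hu' hsum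
      rw [mem_dilPt] at hs hs' ht ht' hu hu'
      subst hs hs' ht ht' hu hu'
      have e0 := congrFun hsum 0
      simp only [Pi.add_apply, Pi.sub_apply, Pi.zero_apply, Nat.cast_one, one_mul,
        Nat.cast_ofNat] at e0
      -- `e0 : i 0 - k 0 + (2 * j 0 - 2 * i 0) + (4 * k 0 - 4 * j 0) = 0`
      have hijk : i 0 = j 0 ∧ j 0 = k 0 := by
        rcases hcase with h | h | h
        · have h0 := congrFun h 0
          have h3k : (3 : F) * (k 0 - i 0) = 0 := by linear_combination e0 - 2 * h0
          have hki : k 0 - i 0 = 0 := (mul_eq_zero.1 h3k).resolve_left h3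
          exact ⟨h0, by linear_combination -h0 - hki⟩
        · have h0 := congrFun h 0
          exact ⟨by linear_combination -e0 - 3 * h0, h0⟩
        · have h0 := congrFun h 0
          have h2k : (2 : F) * (i 0 - j 0) = 0 := by linear_combination e0 - 3 * h0
          have hij : i 0 - j 0 = 0 := (mul_eq_zero.1 h2k).resolve_left h2
          exact ⟨by linear_combination hij, by linear_combination -hij - h0⟩
      have hij : i = j := funext fun l => by rw [Fin.fin_one_eq_zero l]; exact hijk.1
      have hjk : j = k := funext fun l => by rw [Fin.fin_one_eq_zero l]; exact hijk.2
      subst hij hjk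
      exact ⟨rfl, rfl, rfl, rfl, rfl⟩)
    (by
      simp only [card_dilPt, mul_one, Nat.cast_one, Real.one_rpow, sum_const, card_univ,
        Fintype.card_fun, Fintype.card_fin, pow_one, nsmul_eq_mul, Real.rpow_one]
      rfl)
  -- the mass of `J` is `|J| ≤ p = |F|^1`
  simp only [card_dilPt, mul_one, Nat.cast_one, Real.one_rpow, sum_const, nsmul_eq_mul,
    Real.rpow_one] at hJmass
  have hJ : (J.card : ℝ) ≤ Fintype.card F := by
    have h := Finset.card_le_univ J
    rw [Fintype.card_fun, Fintype.card_fin, pow_one] at h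
    exact_mod_cast h
  linarith

/-! ## §2  The pairwise clause is load-bearing: constant families -/

/-- `HexagonClearanceR` with the `≥ 2`-equal-label (pairwise) hypothesis DROPPED (everything else
unchanged). -/
def HexagonClearanceRWithoutPairwise : Prop :=
  ∀ (e m k : ℕ) (φI : Language.ring.Formula (Fin e ⊕ Fin k))
    (φA φB φC : Language.ring.Formula ((Fin e ⊕ Fin m) ⊕ Fin k)),
    ∃ ε₀ : ℝ, 0 < ε₀ ∧ ∀ ε η : ℝ, 0 < ε → ε ≤ ε₀ → 0 < η → ∃ q₁ : ℕ,
      ∀ (F : Type) [Field F] [Fintype F] [FirstOrder.Ring.CompatibleRing F], q₁ ≤ ringChar F →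
        ∀ (y : Fin k → F) (I : Finset (Fin e → F)) (A B C : (Fin e → F) → Finset (Fin m → F)),
          (∀ x, x ∈ I ↔ φI.Realize (Sum.elim x y)) →
          (∀ x v, v ∈ A x ↔ φA.Realize (Sum.elim (Sum.elim x v) y)) →
          (∀ x v, v ∈ B x ↔ φB.Realize (Sum.elim (Sum.elim x v) y)) →
          (∀ x v, v ∈ C x ↔ φC.Realize (Sum.elim (Sum.elim x v) y)) →
          (Fintype.card F : ℝ) ^ ((m : ℝ) + η) ≤
            ∑ x ∈ I, (((A x).card * (B x).card * (C x).card : ℕ) : ℝ) ^ ((2 + ε) / 3) →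
          ∃ J : Finset (Fin e → F), J ⊆ I ∧
            (∀ i ∈ J, ∀ j ∈ J, ∀ k ∈ J, ∀ s ∈ A k, ∀ s' ∈ A i, ∀ t ∈ B i, ∀ t' ∈ B j,
              ∀ u ∈ C j, ∀ u' ∈ C k, (s' - s) + (t' - t) + (u' - u) = 0 →
                i = j ∧ j = k ∧ s = s' ∧ t = t' ∧ u = u') ∧
            (Fintype.card F : ℝ) ^ (m : ℝ) <
              ∑ x ∈ J, (((A x).card * (B x).card * (C x).card : ℕ) : ℝ) ^ ((2 + ε) / 3)

/-- The constant point block `{0} ⊆ F¹` (labels `x : Fin 2 → F` ignored). -/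
def zeroPt (F : Type) [Field F] (_x : Fin 2 → F) : Finset (Fin 1 → F) := {0}

theorem mem_zeroPt {F : Type} [Field F] {x : Fin 2 → F} {v : Fin 1 → F} :
    v ∈ zeroPt F x ↔ v = 0 :=
  Finset.mem_singleton

/-- Ring formula `v₀ = 0` (label `x : Fin 2`, vector `v : Fin 1`, no parameters). -/
def ψ0 : Language.ring.Formula ((Fin 2 ⊕ Fin 1) ⊕ Fin 0) :=
  Term.equal (Term.var (Sum.inl (Sum.inr 0))) 0

theorem mem_zeroPt_iff_realize {F : Type} [Field F] [FirstOrder.Ring.CompatibleRing F]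
    (y : Fin 0 → F) (x : Fin 2 → F) (v : Fin 1 → F) :
    v ∈ zeroPt F x ↔ ψ0.Realize (Sum.elim (Sum.elim x v) y) := by
  rw [mem_zeroPt]
  simp [ψ0, Formula.realize_equal, funext_iff, Fin.forall_fin_one]

/-- **The pairwise clause is load-bearing.**  Without it the CONSTANT family `A_x = B_x = C_x = {0}`
(`x ∈ I = F²`, `m = 1`) has mass `|F|² = |F|^{m+1}` at every exponent, while a fully-STPP
sub-family has at most ONE label (two labels `i ≠ k` violate the clause at `j = i` with all six
elements `0`), so its mass is `≤ 1 < |F|`. -/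
theorem hexagonClearanceR_false_without_pairwise : ¬ HexagonClearanceRWithoutPairwise := by
  intro H
  classical
  obtain ⟨ε₀, hε₀, H1⟩ := H 2 1 0 ⊤ ψ0 ψ0 ψ0
  obtain ⟨q₁, H2⟩ := H1 ε₀ 1 hε₀ le_rfl one_pos
  obtain ⟨p, hpge, hp⟩ := Nat.exists_infinite_primes (max q₁ 2)
  haveI : Fact p.Prime := ⟨hp⟩
  let F := ZMod p
  letI : FirstOrder.Ring.CompatibleRing F := FirstOrder.Ring.compatibleRingOfRing F
  have hchar : q₁ ≤ ringChar F := by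
    rw [ZMod.ringChar_zmod_n]
    exact (le_max_left _ _).trans hpge
  have hQ2 : (2 : ℝ) ≤ Fintype.card F := by
    have h : 2 ≤ Fintype.card F := by rw [ZMod.card]; exact hp.two_le
    exact_mod_cast h
  have key := H2 F hchar ![] univ (zeroPt F) (zeroPt F) (zeroPt F) (fun x => by simp)
    (mem_zeroPt_iff_realize ![]) (mem_zeroPt_iff_realize ![]) (mem_zeroPt_iff_realize ![])
  obtain ⟨J, -, hJclean, hJmass⟩ := key
    (by
      simp only [zeroPt, card_singleton, mul_one, Nat.cast_one, Real.one_rpow, sum_const,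
        card_univ, Fintype.card_fun, Fintype.card_fin, nsmul_eq_mul, Nat.cast_pow]
      rw [show (1 : ℝ) + 1 = ((2 : ℕ) : ℝ) by norm_num, Real.rpow_natCast])
  -- a clean sub-family has at most one label
  have hJ1 : J.card ≤ 1 := by
    refine Finset.card_le_one.2 fun a ha b hb => ?_
    have h := hJclean a ha a ha b hb 0 (by simp [zeroPt]) 0 (by simp [zeroPt]) 0 (by simp [zeroPt])
      0 (by simp [zeroPt]) 0 (by simp [zeroPt]) 0 (by simp [zeroPt]) (by simp)
    exact h.2.1
  simp only [zeroPt, card_singleton, mul_one, Nat.cast_one, Real.one_rpow, sum_const,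
    nsmul_eq_mul, Real.rpow_one] at hJmass
  have hJ1' : (J.card : ℝ) ≤ 1 := by exact_mod_cast hJ1
  linarith

/-! ## §3  The two provisos of the repair (`ε ≤ ε₀`, `q₁ ≤ ringChar F`) cannot BOTH be dropped,
even with the repaired `δ`-free conclusion -/

/-- `HexagonClearanceR` with BOTH repair provisos removed: clearance is asked for every `ε > 0`
(no `ε₀`) and in every finite field with `q₁ ≤ |F|` (instead of `q₁ ≤ char F`); the pairwise
hypothesis, `0 < η` and the `δ`-free conclusion `|F|^m < mass_J` are kept verbatim. -/
def HexagonClearanceRWithoutEps0Char : Prop :=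
  ∀ (e m k : ℕ) (φI : Language.ring.Formula (Fin e ⊕ Fin k))
    (φA φB φC : Language.ring.Formula ((Fin e ⊕ Fin m) ⊕ Fin k)),
    ∀ ε η : ℝ, 0 < ε → 0 < η → ∃ q₁ : ℕ,
      ∀ (F : Type) [Field F] [Fintype F] [FirstOrder.Ring.CompatibleRing F], q₁ ≤ Fintype.card F →
        ∀ (y : Fin k → F) (I : Finset (Fin e → F)) (A B C : (Fin e → F) → Finset (Fin m → F)),
          (∀ x, x ∈ I ↔ φI.Realize (Sum.elim x y)) →
          (∀ x v, v ∈ A x ↔ φA.Realize (Sum.elim (Sum.elim x v) y)) →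
          (∀ x v, v ∈ B x ↔ φB.Realize (Sum.elim (Sum.elim x v) y)) →
          (∀ x v, v ∈ C x ↔ φC.Realize (Sum.elim (Sum.elim x v) y)) →
          (∀ i ∈ I, ∀ j ∈ I, ∀ k ∈ I, (i = j ∨ j = k ∨ k = i) →
            ∀ s ∈ A k, ∀ s' ∈ A i, ∀ t ∈ B i, ∀ t' ∈ B j, ∀ u ∈ C j, ∀ u' ∈ C k,
              (s' - s) + (t' - t) + (u' - u) = 0 → i = j ∧ j = k ∧ s = s' ∧ t = t' ∧ u = u') →
          (Fintype.card F : ℝ) ^ ((m : ℝ) + η) ≤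
            ∑ x ∈ I, (((A x).card * (B x).card * (C x).card : ℕ) : ℝ) ^ ((2 + ε) / 3) →
          ∃ J : Finset (Fin e → F), J ⊆ I ∧
            (∀ i ∈ J, ∀ j ∈ J, ∀ k ∈ J, ∀ s ∈ A k, ∀ s' ∈ A i, ∀ t ∈ B i, ∀ t' ∈ B j,
              ∀ u ∈ C j, ∀ u' ∈ C k, (s' - s) + (t' - t) + (u' - u) = 0 →
                i = j ∧ j = k ∧ s = s' ∧ t = t' ∧ u = u') ∧
            (Fintype.card F : ℝ) ^ (m : ℝ) <
              ∑ x ∈ J, (((A x).card * (B x).card * (C x).card : ℕ) : ℝ) ^ ((2 + ε) / 3)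

/-- The `A`-blocks of the label-only parasite: the vertical line `{v ∈ F² : v₀ = x₀}`. -/
def parLine (F : Type) [Fintype F] [DecidableEq F] (x : Fin 1 → F) : Finset (Fin 2 → F) :=
  univ.filter fun v => v 0 = x 0

/-- The `B`-blocks of the parasite: the origin. -/
def parPtB (F : Type) [Field F] (_x : Fin 1 → F) : Finset (Fin 2 → F) := {0}

/-- The `C`-blocks of the parasite: the point `(−x₀, −x₀)`. -/
def parPtC (F : Type) [Field F] (x : Fin 1 → F) : Finset (Fin 2 → F) := {fun _ => -(x 0)}

/-- Ring formula `v₀ = x₀` (label `x : Fin 1`, vector `v : Fin 2`, no parameters). -/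
def φParLine : Language.ring.Formula ((Fin 1 ⊕ Fin 2) ⊕ Fin 0) :=
  Term.equal (Term.var (Sum.inl (Sum.inr 0))) (Term.var (Sum.inl (Sum.inl 0)))

/-- Ring formula `v₀ = 0 ∧ v₁ = 0`. -/
def φParPtB : Language.ring.Formula ((Fin 1 ⊕ Fin 2) ⊕ Fin 0) :=
  Term.equal (Term.var (Sum.inl (Sum.inr 0))) 0 ⊓ Term.equal (Term.var (Sum.inl (Sum.inr 1))) 0

/-- Ring formula `v₀ + x₀ = 0 ∧ v₁ + x₀ = 0`. -/
def φParPtC : Language.ring.Formula ((Fin 1 ⊕ Fin 2) ⊕ Fin 0) :=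
  Term.equal (Term.var (Sum.inl (Sum.inr 0)) + Term.var (Sum.inl (Sum.inl 0))) 0 ⊓
    Term.equal (Term.var (Sum.inl (Sum.inr 1)) + Term.var (Sum.inl (Sum.inl 0))) 0

theorem mem_parLine {F : Type} [Fintype F] [DecidableEq F] {x : Fin 1 → F} {v : Fin 2 → F} :
    v ∈ parLine F x ↔ v 0 = x 0 := by
  simp [parLine]

theorem mem_parPtB {F : Type} [Field F] {x : Fin 1 → F} {v : Fin 2 → F} :
    v ∈ parPtB F x ↔ v = 0 :=
  Finset.mem_singleton

theorem mem_parPtC {F : Type} [Field F] {x : Fin 1 → F} {v : Fin 2 → F} :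
    v ∈ parPtC F x ↔ v = fun _ => -(x 0) :=
  Finset.mem_singleton

theorem card_parLine {F : Type} [Fintype F] [DecidableEq F] (x : Fin 1 → F) :
    (parLine F x).card = Fintype.card F := by
  rw [← Finset.card_univ (α := F)]
  refine Finset.card_nbij' (fun v => v 1) (fun z l => if l = 0 then x 0 else z) ?_ ?_ ?_ ?_
  · intro v _
    simp
  · intro z _
    simp [mem_parLine]
  · intro v hv
    have hv0 : v 0 = x 0 := mem_parLine.1 (Finset.mem_coe.1 hv)
    funext l
    fin_cases l <;> simp [hv0]
  · intro z _
    simp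

theorem card_parPtB {F : Type} [Field F] (x : Fin 1 → F) : (parPtB F x).card = 1 :=
  Finset.card_singleton _

theorem card_parPtC {F : Type} [Field F] (x : Fin 1 → F) : (parPtC F x).card = 1 :=
  Finset.card_singleton _

theorem mem_parLine_iff_realize {F : Type} [Field F] [Fintype F] [DecidableEq F]
    [FirstOrder.Ring.CompatibleRing F] (y : Fin 0 → F) (x : Fin 1 → F) (v : Fin 2 → F) :
    v ∈ parLine F x ↔ φParLine.Realize (Sum.elim (Sum.elim x v) y) := by
  rw [mem_parLine]
  simp [φParLine, Formula.realize_equal]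

theorem mem_parPtB_iff_realize {F : Type} [Field F] [FirstOrder.Ring.CompatibleRing F]
    (y : Fin 0 → F) (x : Fin 1 → F) (v : Fin 2 → F) :
    v ∈ parPtB F x ↔ φParPtB.Realize (Sum.elim (Sum.elim x v) y) := by
  rw [mem_parPtB]
  simp [φParPtB, Formula.realize_equal, Formula.realize_inf, funext_iff, Fin.forall_fin_two]

theorem mem_parPtC_iff_realize {F : Type} [Field F] [FirstOrder.Ring.CompatibleRing F]
    (y : Fin 0 → F) (x : Fin 1 → F) (v : Fin 2 → F) :
    v ∈ parPtC F x ↔ φParPtC.Realize (Sum.elim (Sum.elim x v) y) := by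
  rw [mem_parPtC]
  simp [φParPtC, Formula.realize_equal, Formula.realize_inf, funext_iff, Fin.forall_fin_two,
    eq_neg_iff_add_eq_zero]

/-- **The pair of provisos {`ε ≤ ε₀`, `q₁ ≤ ringChar F`} is jointly load-bearing, even for the
repaired `δ`-free conclusion.**  Drop both and the label-only parasite of the old seam returns:
`F = GF(3ⁿ)`, `m = 2`, `x ∈ I = F`, `A_x = {x} × F`, `B_x = {0}`, `C_x = {(−x,−x)}` meets every
`≥ 2`-equal-label pattern; at `ε = 1 + 3c₃/2`, `η = c₃/2` (`c₃ = foxLovaszExponent 3 > 0`) its mass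
is `q · q^{1 + c₃/2} = q^{2+η}` exactly; a fully-STPP `J` is a cap set (`i + j = 2k ⇒ i = j = k`),
so `|J| ≤ 3 q^{1−c₃}` (tree `card_le_rpow_of_elementary`) and `mass_J ≤ 3 q^{2−c₃/2} < q² = |F|^m`
once `q^{c₃/2} > 3`.  So in bounded characteristic the conclusion fails at a FIXED `ε > 1`; the
repaired item survives this witness through EITHER proviso (`ε ≤ ε₀ < 1` starves the parasite's mass,
TranslateFamiliesFail; `char F → ∞` sends the cap-set saving `c_p → 0`, Behrend). -/
theorem hexagonClearanceR_false_without_eps0_char : ¬ HexagonClearanceRWithoutEps0Char := by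
  intro H
  classical
  have hc : 0 < Literature.Combinatorics.Additive.foxLovaszExponent 3 :=
    Literature.Combinatorics.Additive.foxLovaszExponent_pos (by norm_num)
  generalize hcdef : Literature.Combinatorics.Additive.foxLovaszExponent 3 = c at hc
  obtain ⟨q₁, hq₁⟩ := H 1 2 0 ⊤ φParLine φParPtB φParPtC (1 + 3 * (c / 2)) (c / 2)
    (by positivity) (half_pos hc)
  -- the field `GF(3ⁿ)`, `n = q₁ + ⌈2/c⌉ + 1`
  obtain ⟨n, hn0, hq₁n, hn2⟩ : ∃ n : ℕ, n ≠ 0 ∧ q₁ ≤ n ∧ (2 / c : ℝ) < n :=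
    ⟨q₁ + ⌈2 / c⌉₊ + 1, by omega, by omega, Nat.lt_of_ceil_lt (by omega)⟩
  let F := GaloisField 3 n
  letI : Fintype F := Fintype.ofFinite F
  letI : FirstOrder.Ring.CompatibleRing F := FirstOrder.Ring.compatibleRingOfRing F
  have hcardF : Fintype.card F = 3 ^ n := by
    rw [← Nat.card_eq_fintype_card]
    exact GaloisField.card 3 n hn0
  have hF : q₁ ≤ Fintype.card F := by
    rw [hcardF]
    exact hq₁n.trans (Nat.lt_pow_self (by norm_num)).le
  have hQpos : (0 : ℝ) < Fintype.card F := by exact_mod_cast Fintype.card_pos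
  have h3 : (3 : F) = 0 := by
    have h := CharP.cast_eq_zero F 3
    simpa using h
  have hG : ∀ x : F, 3 • x = 0 := fun x => by
    rw [nsmul_eq_mul, Nat.cast_ofNat, h3, zero_mul]
  -- instantiate the variant at the parasite family
  have key := hq₁ F hF ![] univ (parLine F) (parPtB F) (parPtC F) (fun x => by simp)
    (mem_parLine_iff_realize ![]) (mem_parPtB_iff_realize ![]) (mem_parPtC_iff_realize ![])
  obtain ⟨J, -, hJstpp, hJmass⟩ := key
    (by
      intro i _ j _ k _ hcase s hs s' hs' t ht t' ht' u hu u' hu' hsum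
      rw [mem_parLine] at hs hs'
      rw [mem_parPtB] at ht ht'
      rw [mem_parPtC] at hu hu'
      subst ht ht' hu hu'
      have e0 := congrFun hsum 0
      have e1 := congrFun hsum 1
      simp only [Pi.add_apply, Pi.sub_apply, Pi.zero_apply] at e0 e1
      have hijk : i 0 = j 0 ∧ j 0 = k 0 := by
        rcases hcase with h | h | h
        · have h0 := congrFun h 0
          exact ⟨h0, by linear_combination (j 0 - k 0) * h3 - e0 + hs' - hs + h0⟩
        · have h0 := congrFun h 0
          exact ⟨by linear_combination e0 - hs' + hs - 2 * h0, h0⟩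
        · have h0 := congrFun h 0
          exact ⟨by linear_combination hs' - e0 - hs - 2 * h0,
            by linear_combination e0 - hs' + hs + h0⟩
      have hij : i = j := funext fun l => by rw [Fin.fin_one_eq_zero l]; exact hijk.1
      have hjk : j = k := funext fun l => by rw [Fin.fin_one_eq_zero l]; exact hijk.2
      refine ⟨hij, hjk, funext (Fin.forall_fin_two.2 ⟨?_, ?_⟩), rfl, by rw [hjk]⟩
      · linear_combination hs - hs' - hijk.1 - hijk.2
      · linear_combination hijk.2 - e1)
    (by
      simp only [card_parLine, card_parPtB, card_parPtC, mul_one, sum_const, card_univ,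
        Fintype.card_fun, Fintype.card_fin, pow_one, nsmul_eq_mul, Nat.cast_ofNat]
      rw [show ((2 : ℝ) + (1 + 3 * (c / 2))) / 3 = 1 + c / 2 by ring,
        show (2 : ℝ) + c / 2 = 1 + (1 + c / 2) by ring, Real.rpow_add hQpos, Real.rpow_one])
  -- a fully-STPP sub-family is a tricolored sum-free set `(x, x, x)_{x ∈ J}` in `(F,+)`, `3·F = 0`
  have hTSF : Literature.Combinatorics.Additive.IsTricoloredSumFree
      (fun a : ↥J => (a.1 0 : F)) (fun a : ↥J => a.1 0) (fun a : ↥J => a.1 0) := by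
    intro a b d
    constructor
    · intro hsum
      have h := hJstpp a.1 a.2 b.1 b.2 d.1 d.2 (fun _ => d.1 0) (by simp [mem_parLine])
        (fun _ => a.1 0) (by simp [mem_parLine]) 0 (by simp [mem_parPtB]) 0 (by simp [mem_parPtB])
        (fun _ => -(b.1 0)) (by simp [mem_parPtC]) (fun _ => -(d.1 0)) (by simp [mem_parPtC])
        (by
          funext l
          simp only [Pi.add_apply, Pi.sub_apply, Pi.zero_apply]
          linear_combination hsum - (d.1 0) * h3)
      exact ⟨Subtype.ext h.1, Subtype.ext h.2.1⟩
    · rintro ⟨rfl, rfl⟩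
      linear_combination (a.1 0) * h3
  have hJle := Literature.Barriers.MatrixMultiplication.card_le_rpow_of_elementary
    Nat.prime_three F hG ↥J _ _ _ hTSF
  rw [Fintype.card_coe, hcdef] at hJle
  -- the mass of `J`
  simp only [card_parLine, card_parPtB, card_parPtC, mul_one, sum_const, nsmul_eq_mul,
    Nat.cast_ofNat] at hJmass
  -- `3 < q^{c/2}` since `q = 3ⁿ`, `n c / 2 > 1`
  have h3lt : (3 : ℝ) < (Fintype.card F : ℝ) ^ (c / 2) := by
    have hQ3 : (Fintype.card F : ℝ) = (3 : ℝ) ^ (n : ℝ) := by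
      rw [hcardF]
      push_cast
      exact (Real.rpow_natCast 3 n).symm
    have h1lt : (1 : ℝ) < n * (c / 2) := by
      have h1 : (2 / c) * (c / 2) = (1 : ℝ) := by field_simp
      calc (1 : ℝ) = (2 / c) * (c / 2) := h1.symm
        _ < n * (c / 2) := by gcongr
    rw [hQ3, ← Real.rpow_mul (by norm_num : (0 : ℝ) ≤ 3)]
    calc (3 : ℝ) = 3 ^ (1 : ℝ) := (Real.rpow_one 3).symm
      _ < 3 ^ ((n : ℝ) * (c / 2)) := Real.rpow_lt_rpow_of_exponent_lt (by norm_num) h1lt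
  -- contradiction: q² < |J| q^{1+c/2} ≤ 3 q^{1-c} q^{1+c/2} < q^{c/2} q^{1-c} q^{1+c/2} = q²
  have key2 : (Fintype.card F : ℝ) ^ (2 : ℝ) < (Fintype.card F : ℝ) ^ (2 : ℝ) :=
    calc (Fintype.card F : ℝ) ^ (2 : ℝ)
        < (J.card : ℝ) * (Fintype.card F : ℝ) ^ (((2 : ℝ) + (1 + 3 * (c / 2))) / 3) := hJmass
      _ ≤ 3 * (Fintype.card F : ℝ) ^ (1 - c) *
            (Fintype.card F : ℝ) ^ (((2 : ℝ) + (1 + 3 * (c / 2))) / 3) :=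
          mul_le_mul_of_nonneg_right hJle (Real.rpow_nonneg hQpos.le _)
      _ < (Fintype.card F : ℝ) ^ (c / 2) * (Fintype.card F : ℝ) ^ (1 - c) *
            (Fintype.card F : ℝ) ^ (((2 : ℝ) + (1 + 3 * (c / 2))) / 3) :=
          mul_lt_mul_of_pos_right (mul_lt_mul_of_pos_right h3lt (Real.rpow_pos_of_pos hQpos _))
            (Real.rpow_pos_of_pos hQpos _)
      _ = (Fintype.card F : ℝ) ^ (c / 2 + (1 - c) + ((2 : ℝ) + (1 + 3 * (c / 2))) / 3) := by
          rw [Real.rpow_add hQpos, Real.rpow_add hQpos]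
      _ = (Fintype.card F : ℝ) ^ (2 : ℝ) := by
          congr 1
          ring
  exact lt_irrefl _ key2



/-! ## §4  `ε ≤ ε₀` ALONE is load-bearing (large characteristic kept), modulo Bourgain–Chang:
the MOMENT FAN parasite in `F⁵` -/

/-- **Named-fact shape (Bourgain–Chang 2017, Cor. 1.2, "quadratic Roth on `𝔽_p`"):** there are
`C, p₀` such that every `J ⊆ ℤ/p`, `p ≥ p₀` prime, with `|J| > C·p^{14/15}` contains `x, x+y, x+y·y`
with `y ∉ {0, 1}`.  (Their Cor. 1.2 gives `≳ δ³p²` pairs `(x,y)`, `y ≠ 0`, once `δ > c₁p^{−1/15}`;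
`y = 1` accounts for `≤ p` of them.  Improved exponents: Peluse 2018; Dong–Li–Sawin 2020.)
[cite: J. Bourgain, M.-C. Chang, Nonlinear Roth type theorems in finite fields, Israel J. Math. 221
(2017), arXiv:1608.05448, Cor. 1.2] -/
def NonlinearRothBC : Prop :=
  ∃ (C : ℝ) (p₀ : ℕ), ∀ p : ℕ, p₀ ≤ p → p.Prime → ∀ J : Finset (ZMod p),
    C * (p : ℝ) ^ ((14 : ℝ) / 15) < J.card →
      ∃ x y : ZMod p, y ≠ 0 ∧ y ≠ 1 ∧ x ∈ J ∧ x + y ∈ J ∧ x + y * y ∈ J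

/-- `HexagonClearanceR` with ONLY the proviso `ε ≤ ε₀` removed (`∀ ε > 0`; large characteristic,
pairwise clause, mass hypothesis and `δ`-free conclusion verbatim). -/
def HexagonClearanceRWithoutEps0 : Prop :=
  ∀ (e m k : ℕ) (φI : Language.ring.Formula (Fin e ⊕ Fin k))
    (φA φB φC : Language.ring.Formula ((Fin e ⊕ Fin m) ⊕ Fin k)),
    ∀ ε η : ℝ, 0 < ε → 0 < η → ∃ q₁ : ℕ,
      ∀ (F : Type) [Field F] [Fintype F] [FirstOrder.Ring.CompatibleRing F], q₁ ≤ ringChar F →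
        ∀ (y : Fin k → F) (I : Finset (Fin e → F)) (A B C : (Fin e → F) → Finset (Fin m → F)),
          (∀ x, x ∈ I ↔ φI.Realize (Sum.elim x y)) →
          (∀ x v, v ∈ A x ↔ φA.Realize (Sum.elim (Sum.elim x v) y)) →
          (∀ x v, v ∈ B x ↔ φB.Realize (Sum.elim (Sum.elim x v) y)) →
          (∀ x v, v ∈ C x ↔ φC.Realize (Sum.elim (Sum.elim x v) y)) →
          (∀ i ∈ I, ∀ j ∈ I, ∀ k ∈ I, (i = j ∨ j = k ∨ k = i) →
            ∀ s ∈ A k, ∀ s' ∈ A i, ∀ t ∈ B i, ∀ t' ∈ B j, ∀ u ∈ C j, ∀ u' ∈ C k,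
              (s' - s) + (t' - t) + (u' - u) = 0 → i = j ∧ j = k ∧ s = s' ∧ t = t' ∧ u = u') →
          (Fintype.card F : ℝ) ^ ((m : ℝ) + η) ≤
            ∑ x ∈ I, (((A x).card * (B x).card * (C x).card : ℕ) : ℝ) ^ ((2 + ε) / 3) →
          ∃ J : Finset (Fin e → F), J ⊆ I ∧
            (∀ i ∈ J, ∀ j ∈ J, ∀ k ∈ J, ∀ s ∈ A k, ∀ s' ∈ A i, ∀ t ∈ B i, ∀ t' ∈ B j,
              ∀ u ∈ C j, ∀ u' ∈ C k, (s' - s) + (t' - t) + (u' - u) = 0 →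
                i = j ∧ j = k ∧ s = s' ∧ t = t' ∧ u = u') ∧
            (Fintype.card F : ℝ) ^ (m : ℝ) <
              ∑ x ∈ J, (((A x).card * (B x).card * (C x).card : ℕ) : ℝ) ^ ((2 + ε) / 3)

/-- **`ε ≤ ε₀` alone is load-bearing, modulo Bourgain–Chang** (landed def-free as
`Theorems/HexagonClearanceR/Negative/WithoutEps0OfNonlinearRoth.lean`, p147419).  Witness: the
MOMENT FAN in `F⁵` over `𝔽_p` (labels `x ∈ F`):
  `A_x = {(0, x, 0, −x, −x)}`,  `B_x = F·(1, x, 0, 0, x²)`,  `C_x = (0,0,0,0,−x) + F·(0, 0, 1, x, x²)`.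
Colour classes are lines whose DIRECTIONS move with the label along conics — what no label-only
parasite can do — and the hexagon relation acquires a cross term: with
`E = det(w, d_B(i), d_B(j), d_C(j), d_C(k)) = (j−i)(j−k)·[(k−i)² − (j−i)]` (linear-algebra search
`toy/polysolve5.py`, brute force `toy/verify_fan.py` over `𝔽₅, 𝔽₇`):
  * every `≥ 2`-equal-label pattern holds identically in EVERY field (no characteristic condition);
  * distinct `(i,j,k)` violate the clause iff `(k−i)² = j−i` iff `(i,k,j) = (x, x+y, x+y²)`, `y ∉ {0,1}`;
  * mass `q^{1+2(2+ε)/3} = q^{5+η}` at `ε = 4 + 3η/2` — here `ε = 4 + 1/20`, `η = 1/30`;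
  * so a fully-STPP `J` avoids `x, x+y, x+y²` and has `|J| ≤ C p^{28/30}`, while the conclusion needs
    `|J| > p^{29/30}`.
Reading: large characteristic clears LINEAR hexagon relations (Behrend) but not nonlinear ones (the
power saving survives `p → ∞`); the parasites live at `ε > 1` (thin, unequal blocks), exactly what
`ε ≤ ε₀ < 1` removes.  So of the two repair provisos, `ε ≤ ε₀` is the essential one; `q₁ ≤ ringChar F`
is redundant modulo `DefinableTranslateRecurrence` (§0). -/
theorem hexagonClearanceR_false_without_eps0_of_nonlinearRoth (hBC : NonlinearRothBC) :
    ¬ HexagonClearanceRWithoutEps0 := by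
  intro H
  classical
  obtain ⟨C₀, p₀, hBC⟩ := hBC
  -- ring terms/formulas (label `x : Fin 1`, vector `v : Fin 5`, no parameters)
  let X : Language.ring.Term ((Fin 1 ⊕ Fin 5) ⊕ Fin 0) := Term.var (Sum.inl (Sum.inl 0))
  let V : Fin 5 → Language.ring.Term ((Fin 1 ⊕ Fin 5) ⊕ Fin 0) :=
    fun r => Term.var (Sum.inl (Sum.inr r))
  -- `φA : v₀ = 0 ∧ v₁ = x ∧ v₂ = 0 ∧ v₃ + x = 0 ∧ v₄ + x = 0`
  let φA : Language.ring.Formula ((Fin 1 ⊕ Fin 5) ⊕ Fin 0) :=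
    Term.equal (V 0) 0 ⊓ Term.equal (V 1) X ⊓ Term.equal (V 2) 0 ⊓ Term.equal (V 3 + X) 0 ⊓
      Term.equal (V 4 + X) 0
  -- `φB : v₁ = v₀·x ∧ v₂ = 0 ∧ v₃ = 0 ∧ v₄ = v₀·x·x`
  let φB : Language.ring.Formula ((Fin 1 ⊕ Fin 5) ⊕ Fin 0) :=
    Term.equal (V 1) (V 0 * X) ⊓ Term.equal (V 2) 0 ⊓ Term.equal (V 3) 0 ⊓
      Term.equal (V 4) (V 0 * X * X)
  -- `φC : v₀ = 0 ∧ v₁ = 0 ∧ v₃ = v₂·x ∧ v₄ + x = v₂·x·x`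
  let φC : Language.ring.Formula ((Fin 1 ⊕ Fin 5) ⊕ Fin 0) :=
    Term.equal (V 0) 0 ⊓ Term.equal (V 1) 0 ⊓ Term.equal (V 3) (V 2 * X) ⊓
      Term.equal (V 4 + X) (V 2 * X * X)
  obtain ⟨q₁, hq₁⟩ := H 1 5 0 ⊤ φA φB φC (4 + 1 / 20) (1 / 30) (by norm_num) (by norm_num)
  -- the constant of the Roth hypothesis, made `≥ 1`
  set C : ℝ := max C₀ 1 with hCdef
  have hC1 : 1 ≤ C := le_max_right _ _
  have hC0 : 0 < C := by linarith
  -- a prime `p ≥ max(q₁, p₀, ⌈C⌉^30)`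
  obtain ⟨p, hpge, hp⟩ := Nat.exists_infinite_primes (max q₁ (max p₀ (⌈C⌉₊ ^ 30)))
  haveI : Fact p.Prime := ⟨hp⟩
  have hpq₁ : q₁ ≤ p := (le_max_left _ _).trans hpge
  have hpp₀ : p₀ ≤ p := ((le_max_left _ _).trans (le_max_right _ _)).trans hpge
  have hpC : ⌈C⌉₊ ^ 30 ≤ p := ((le_max_right _ _).trans (le_max_right _ _)).trans hpge
  let F := ZMod p
  letI : FirstOrder.Ring.CompatibleRing F := FirstOrder.Ring.compatibleRingOfRing F
  have hchar : q₁ ≤ ringChar F := by rwa [ZMod.ringChar_zmod_n]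
  have hcardF : Fintype.card F = p := ZMod.card p
  have hQpos : (0 : ℝ) < Fintype.card F := by exact_mod_cast Fintype.card_pos
  have hQ1 : (1 : ℝ) < Fintype.card F := by exact_mod_cast Fintype.one_lt_card
  -- the moment fan
  let av : (Fin 1 → F) → (Fin 5 → F) := fun x => ![0, x 0, 0, -(x 0), -(x 0)]
  let bv : (Fin 1 → F) → F → (Fin 5 → F) := fun x b => ![b, b * x 0, 0, 0, b * x 0 * x 0]
  let cv : (Fin 1 → F) → F → (Fin 5 → F) :=
    fun x c => ![0, 0, c, c * x 0, c * x 0 * x 0 - x 0]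
  let A : (Fin 1 → F) → Finset (Fin 5 → F) := fun x => {av x}
  let B : (Fin 1 → F) → Finset (Fin 5 → F) := fun x => univ.image (bv x)
  let Cc : (Fin 1 → F) → Finset (Fin 5 → F) := fun x => univ.image (cv x)
  have bv_inj : ∀ x, Function.Injective (bv x) := fun x b b' h => by
    have := congrFun h 0; simpa [bv] using this
  have cv_inj : ∀ x, Function.Injective (cv x) := fun x c c' h => by
    have := congrFun h 2; simpa [cv] using this
  have cardA : ∀ x, (A x).card = 1 := fun x => card_singleton _
  have cardB : ∀ x, (B x).card = Fintype.card F := fun x => by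
    simp only [B, card_image_of_injective _ (bv_inj x), card_univ]
  have cardC : ∀ x, (Cc x).card = Fintype.card F := fun x => by
    simp only [Cc, card_image_of_injective _ (cv_inj x), card_univ]
  have memA : ∀ {x v}, v ∈ A x ↔ v = av x := fun {x v} => mem_singleton
  have memB : ∀ {x v}, v ∈ B x ↔ ∃ b, bv x b = v := fun {x v} => by simp [B]
  have memC : ∀ {x v}, v ∈ Cc x ↔ ∃ c, cv x c = v := fun {x v} => by simp [Cc]
  -- realisation lemmas
  have realA : ∀ (x : Fin 1 → F) (v : Fin 5 → F),
      v ∈ A x ↔ φA.Realize (Sum.elim (Sum.elim x v) ![]) := by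
    intro x v
    rw [memA]
    simp only [φA, V, X, av, Formula.realize_inf, Formula.realize_equal, Term.realize_var,
      Sum.elim_inl, Sum.elim_inr, FirstOrder.Ring.realize_add, FirstOrder.Ring.realize_zero,
      funext_iff, Fin.forall_fin_succ]
    simp [add_eq_zero_iff_eq_neg, and_assoc]
  have realB : ∀ (x : Fin 1 → F) (v : Fin 5 → F),
      v ∈ B x ↔ φB.Realize (Sum.elim (Sum.elim x v) ![]) := by
    intro x v
    rw [memB]
    simp only [φB, V, X, bv, Formula.realize_inf, Formula.realize_equal, Term.realize_var,
      Sum.elim_inl, Sum.elim_inr, FirstOrder.Ring.realize_mul, FirstOrder.Ring.realize_zero]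
    constructor
    · rintro ⟨b, rfl⟩
      simp
    · rintro ⟨⟨⟨h1, h2⟩, h3⟩, h4⟩
      refine ⟨v 0, ?_⟩
      funext r
      fin_cases r <;> simp [h1, h2, h3, h4]
  have realC : ∀ (x : Fin 1 → F) (v : Fin 5 → F),
      v ∈ Cc x ↔ φC.Realize (Sum.elim (Sum.elim x v) ![]) := by
    intro x v
    rw [memC]
    simp only [φC, V, X, cv, Formula.realize_inf, Formula.realize_equal, Term.realize_var,
      Sum.elim_inl, Sum.elim_inr, FirstOrder.Ring.realize_mul, FirstOrder.Ring.realize_add,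
      FirstOrder.Ring.realize_zero]
    constructor
    · rintro ⟨c, rfl⟩
      simp
    · rintro ⟨⟨⟨h1, h2⟩, h3⟩, h4⟩
      refine ⟨v 2, ?_⟩
      funext r
      fin_cases r <;> simp [h1, h2, h3]
      linear_combination -h4
  -- instantiate the `ε₀`-free seam at the fan
  have key := hq₁ F hchar ![] univ A B Cc (fun x => by simp) realA realB realC
  obtain ⟨J, -, hJstpp, hJmass⟩ := key
    (by
      intro i _ j _ k _ hcase s hs s' hs' t ht t' ht' u hu u' hu' hsum
      rw [memA] at hs hs'
      obtain ⟨b, rfl⟩ := memB.1 ht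
      obtain ⟨b', rfl⟩ := memB.1 ht'
      obtain ⟨c, rfl⟩ := memC.1 hu
      obtain ⟨c', rfl⟩ := memC.1 hu'
      subst hs hs'
      have e0 : b' - b = 0 := by have := congrFun hsum 0; simpa [av, bv, cv] using this
      have e1 : (i 0 - k 0) + (b' * j 0 - b * i 0) = 0 := by
        have := congrFun hsum 1; simpa [av, bv, cv] using this
      have e2 : c' - c = 0 := by
        have := congrFun hsum 2; simp [av, bv, cv] at this; linear_combination this
      have e3 : (-(i 0) + k 0) + (c' * k 0 - c * j 0) = 0 := by
        have := congrFun hsum 3; simp [av, bv, cv] at this; linear_combination this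
      have e4 : (-(i 0) + k 0) + (b' * j 0 * j 0 - b * i 0 * i 0) +
          ((c' * k 0 * k 0 - k 0) - (c * j 0 * j 0 - j 0)) = 0 := by
        have := congrFun hsum 4; simp [av, bv, cv] at this; linear_combination this
      have hb : b' = b := by linear_combination e0
      have hc : c' = c := by linear_combination e2
      subst hb hc
      have hijk : i 0 = j 0 ∧ j 0 = k 0 := by
        rcases hcase with h | h | h
        · have h0 := congrFun h 0
          exact ⟨h0, by linear_combination e1 + b' * h0 - h0⟩
        · have h0 := congrFun h 0
          exact ⟨by linear_combination (-1 : F) * e3 - c' * h0 - h0, h0⟩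
        · have h0 := congrFun h 0
          -- `k = i`: `b'(j-i) = 0`, `c'(i-j) = 0`, `(j-i)((b'-c')(j+i) + 1) = 0`
          by_contra hne
          have hji : j 0 - i 0 ≠ 0 := by
            intro h'
            exact hne ⟨by linear_combination -h', by linear_combination h' - h0⟩
          have hb0 : b' = 0 := by
            have : b' * (j 0 - i 0) = 0 := by linear_combination e1 + h0
            exact (mul_eq_zero.1 this).resolve_right hji
          have hc0 : c' = 0 := by
            have : c' * (i 0 - j 0) = 0 := by linear_combination e3 - (1 + c') * h0
            rcases mul_eq_zero.1 this with h' | h'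
            · exact h'
            · exact absurd (by linear_combination -h' : j 0 - i 0 = 0) hji
          subst hb0 hc0
          apply hji
          linear_combination e4
      have hij : i = j := funext fun l => by rw [Fin.fin_one_eq_zero l]; exact hijk.1
      have hjk : j = k := funext fun l => by rw [Fin.fin_one_eq_zero l]; exact hijk.2
      subst hij hjk
      exact ⟨rfl, rfl, rfl, rfl, rfl⟩)
    (by
      simp only [cardA, cardB, cardC, one_mul, sum_const, card_univ, Fintype.card_fun,
        Fintype.card_fin, pow_one, nsmul_eq_mul, Nat.cast_mul, Nat.cast_ofNat]
      rw [← sq, ← Real.rpow_natCast _ 2, ← Real.rpow_mul hQpos.le,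
        show (5 : ℝ) + 1 / 30 = 1 + (2 : ℕ) * ((2 + (4 + 1 / 20)) / 3) by norm_num,
        Real.rpow_add hQpos, Real.rpow_one])
  -- mass of `J`: `p⁵ < |J| · p^{121/30}`, so `|J| > p^{29/30}`
  simp only [cardA, cardB, cardC, one_mul, sum_const, nsmul_eq_mul, Nat.cast_mul,
    Nat.cast_ofNat] at hJmass
  rw [← sq, ← Real.rpow_natCast _ 2, ← Real.rpow_mul hQpos.le] at hJmass
  have hexp : (Fintype.card F : ℝ) ^ (5 : ℝ) =
      (Fintype.card F : ℝ) ^ ((29 : ℝ) / 30) *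
        (Fintype.card F : ℝ) ^ ((2 : ℕ) * ((2 + (4 + 1 / 20)) / 3) : ℝ) := by
    rw [← Real.rpow_add hQpos]; norm_num
  rw [hexp] at hJmass
  have hJlow : (Fintype.card F : ℝ) ^ ((29 : ℝ) / 30) < J.card :=
    lt_of_mul_lt_mul_right hJmass (Real.rpow_nonneg hQpos.le _)
  -- `C p^{14/15} ≤ p^{29/30}` because `p^{1/30} ≥ ⌈C⌉ ≥ C`
  have hp30 : C ≤ (Fintype.card F : ℝ) ^ ((1 : ℝ) / 30) := by
    have h1 : (C : ℝ) ≤ ⌈C⌉₊ := Nat.le_ceil C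
    have h2 : ((⌈C⌉₊ : ℕ) : ℝ) = (((⌈C⌉₊ ^ 30 : ℕ) : ℝ)) ^ ((1 : ℝ) / 30) := by
      push_cast
      rw [show (1 : ℝ) / 30 = ((30 : ℕ) : ℝ)⁻¹ by norm_num,
        Real.pow_rpow_inv_natCast (Nat.cast_nonneg _) (by norm_num)]
    have h3 : (((⌈C⌉₊ ^ 30 : ℕ) : ℝ)) ^ ((1 : ℝ) / 30) ≤ (Fintype.card F : ℝ) ^ ((1 : ℝ) / 30) := by
      apply Real.rpow_le_rpow (Nat.cast_nonneg _) _ (by norm_num)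
      rw [hcardF]; exact_mod_cast hpC
    linarith [h2 ▸ h3]
  have hJbig : C₀ * (p : ℝ) ^ ((14 : ℝ) / 15) < (J.image fun v : Fin 1 → F => v 0).card := by
    have hinj : Function.Injective fun v : Fin 1 → F => v 0 := fun v w h =>
      funext fun l => by rw [Fin.fin_one_eq_zero l]; exact h
    rw [card_image_of_injective _ hinj]
    have hq : (p : ℝ) = Fintype.card F := by rw [hcardF]
    calc C₀ * (p : ℝ) ^ ((14 : ℝ) / 15)
        ≤ C * (p : ℝ) ^ ((14 : ℝ) / 15) :=
          mul_le_mul_of_nonneg_right (le_max_left _ _) (Real.rpow_nonneg (Nat.cast_nonneg _) _)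
      _ ≤ (Fintype.card F : ℝ) ^ ((1 : ℝ) / 30) * (Fintype.card F : ℝ) ^ ((14 : ℝ) / 15) := by
          rw [hq]; exact mul_le_mul_of_nonneg_right hp30 (Real.rpow_nonneg hQpos.le _)
      _ = (Fintype.card F : ℝ) ^ ((29 : ℝ) / 30) := by
          rw [← Real.rpow_add hQpos]; norm_num
      _ < J.card := hJlow
  -- Bourgain–Chang: a progression `x, x + y, x + y²` (`y ∉ {0,1}`) inside the labels of `J`
  obtain ⟨x, y, hy0, hy1, hx, hxy, hxyy⟩ := hBC p hpp₀ hp _ hJbig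
  have lab : ∀ {a : F}, a ∈ J.image (fun v : Fin 1 → F => v 0) → (fun _ : Fin 1 => a) ∈ J := by
    intro a ha
    obtain ⟨v, hv, rfl⟩ := mem_image.1 ha
    have : (fun _ : Fin 1 => v 0) = v := funext fun l => by rw [Fin.fin_one_eq_zero l]
    rwa [this]
  have hi := lab hx
  have hk := lab hxy
  have hj := lab hxyy
  -- the violating hexagon: `i = x`, `j = x + y²`, `k = x + y`, `b = 1/y`, `c = 1/(y-1)`
  have hy1' : y - 1 ≠ 0 := sub_ne_zero.2 hy1
  set i : Fin 1 → F := fun _ => x with hidef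
  set j : Fin 1 → F := fun _ => x + y * y with hjdef
  set k : Fin 1 → F := fun _ => x + y with hkdef
  have hy1'' : (-1 : F) + y ≠ 0 := by intro h; apply hy1'; linear_combination h
  have hyinv : y⁻¹ * y = 1 := inv_mul_cancel₀ hy0
  have hzinv : ((-1 : F) + y)⁻¹ * (-1 + y) = 1 := inv_mul_cancel₀ hy1''
  have key := hJstpp i hi j hj k hk (av k) (memA.2 rfl) (av i) (memA.2 rfl)
    (bv i y⁻¹) (memB.2 ⟨_, rfl⟩) (bv j y⁻¹) (memB.2 ⟨_, rfl⟩)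
    (cv j ((-1 : F) + y)⁻¹) (memC.2 ⟨_, rfl⟩) (cv k ((-1 : F) + y)⁻¹) (memC.2 ⟨_, rfl⟩)
    (by
      funext r
      fin_cases r
      · simp [av, bv, cv]
      · simp [av, bv, cv, i, j, k]
        linear_combination y * hyinv
      · simp [av, bv, cv]
      · simp [av, bv, cv, i, j, k]
        linear_combination (-y) * hzinv
      · simp [av, bv, cv, i, j, k]
        linear_combination (2 * x * y + y ^ 3) * hyinv - y * (2 * x + y + y ^ 2) * hzinv)
  have hx0 : x = x + y * y := by simpa [i, j] using congrFun key.1 0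
  exact hy0 (mul_self_eq_zero.1 (by linear_combination -hx0))

/-! ## §5  (superseded by §4, kept as a record) the first nonlinear attempt: a label-only parasite
with relation `i + j² = k + k²`, whose Roth bound is NOT in print.  §4 found a better shape.

Family (prime field `𝔽_p`, `p ≡ 3 (mod 4)`, `m = 2`, `e = 1`, one parameter `½`):
  `I = {j : j and j + ½ are non-zero squares}` (density 1/4; `I ∩ −I = ∅ = I ∩ (−1 − I)` because
  `χ(−1) = −1`), `A_x = F × {x}`, `B_x = {(0,0)}`, `C_x = {(0, −x²)}`.
  * block TPP: trivial (line, point, point);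
  * pattern sums have second coordinate `(i − k) + (j² − k²)·(−1)…` precisely: violation of the clause
    at labels `(i,j,k)` ⟺ `i + j² = k + k²`; with two labels equal this forces the third
    (`j = ±i`, `k ∈ {i, −1−i}`, resp. `i = j`), and `I` excludes the spurious branches — so the family
    is PAIRWISE CLEAN;
  * mass `|I|·p^{(2+ε)/3} ≥ p^{2+η}` at `ε = 1 + 6η`, `p ≥ 4^{1/η}`;
  * a clean `J ⊆ I` is exactly a set without distinct solutions of `i + j² = k + k²`
    (`i − k = (k−j)(k+j)`), and the variant dies iff such sets have `|J| ≤ C p^{1−γ}` with `γ > 2η`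
    for a FIXED γ — a Bourgain–Chang/Peluse-type power saving for this 2-parameter quadratic pattern.
  Fourier alone gives it only for `J` with `max_{ξ≠0} |Σ_{j∈J} e_p(ξ j²)| ≤ |J|²/(2p)` (computed in
  NOTES.md); the structured case needs degree lowering.  Linear choices (`C_x = {(0,−λx)}`) give
  `i + λj = (1+λ)k`, cleared by Behrend sets at cost `p^{−O(1/√log p)}` — the variant HOLDS there,
  which is why `q₁ ≤ ringChar F` + Behrend is the provers' positive mechanism (cards
  salem-spencer-level-hashing, graded-layout-behrend).
-/

end

end Summit.MatrixMultiplication.MatrixMultiplication.Cruxes.HexagonClearanceR.Disproof
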